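import Literature.AlgebraicGeometry.Resolution.BlowupSequences
import Literature.AlgebraicGeometry.Resolution.StrictTransformCurveDelta
import Literature.AlgebraicGeometry.Resolution.QuasiExcellentCurveDelta
import Literature.AlgebraicGeometry.Resolution.QuasiExcellentSchemesProofs
import Literature.AlgebraicGeometry.Resolution.ResolutionOfComponentsRegularLocus
import Literature.AlgebraicGeometry.Resolution.QuasiExcellentClosedSubschemes
import Literature.AlgebraicGeometry.Resolution.QuasiExcellentBlowup
import Literature.AlgebraicGeometry.Resolution.HilbertSamuelIsolatedSingularities
import Literature.AlgebraicGeometry.Resolution.RegularLocusDense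
import Literature.AlgebraicGeometry.Resolution.BlowupDimension
import Mathlib.AlgebraicGeometry.Morphisms.Proper
import Mathlib.AlgebraicGeometry.Noetherian
import HarnessLib

/-!
# `SigmaMaxModifications` (crux stmt-ResolutionOfSingularities-18506, line `Sketch`):
# stub `stub_curveResolution` — resolution of reduced excellent curves, isomorphic over `Reg`

Stub `stub_curveResolution` of the lead skeleton `Sketch` for the crux
`Summit.ResolutionOfSingularities.ResolutionOfSingularities.Theses.HilbertSamuelElimination.SigmaMaxModifications`:
every reduced separated excellent Noetherian scheme `Y` of dimension `≤ 1` has a resolution of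
singularities `ρ : Y' → Y` (`IsResolution`: proper, birational, `Y'` regular) which is an
isomorphism over an open `V ⊆ Y` whose points are exactly `Reg Y`.

Proof (Kollár 2007, §1.4: "blowing up singular points of a curve terminates, the `δ`-invariant
drops"; Cossart–Piltant 2019, proof of Prop. 4.6, Step 1 for the reduction to components):

* **integral case** (`centreSeq_of_integral_curve_aux`): for an integral Noetherian quasi-excellent
  `X` of dimension `≤ 1`, strong induction on the total `δ`-invariant `Σ_y δ(𝒪_{X,y}) < ∞`
  (`finite_support_pointDelta`, `pointDelta_ne_top`, `QuasiExcellentCurveDelta.lean`) produces a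
  finite sequence of point blow-ups `s : CentreSeq X` with centres over `X ∖ Reg X` and regular last
  scheme: if `X` is regular take the empty sequence; otherwise a singular point `x` is closed with
  `dim 𝒪_{X,x} = 1` and `𝒪_{X,x}` not a discrete valuation ring, the blow-up `X₁ = Bl_{{x}} X` of
  the reduced point is again an integral Noetherian quasi-excellent curve
  (`IsBlowup.isIntegral`, `IsBlowup.isQuasiExcellent`, `IsBlowup.topologicalKrullDim_le`) with
  `δ(X₁) < δ(X)` (`IsBlowup.finsum_pointDelta_lt_of_vanishingIdeal`); recurse and prepend the
  centre (`CentreSeq.centresOver_compl_regularLocus_cons`). Then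
  `exists_isResolution_of_centreSeq` (the composite is proper, birational, an isomorphism over the
  dense open `Reg X`).
* **reduced case**: `exists_isResolution_regularLocus_of_irreducibleComponents` with the property
  "closed subscheme of `Y`" (closed subschemes of a Noetherian quasi-excellent scheme of
  dimension `≤ 1` are Noetherian quasi-excellent of dimension `≤ 1`,
  `Scheme.IsQuasiExcellent.of_isClosedImmersion`, `IsInducing.topologicalKrullDim_le`).

No Hilbert–Samuel bookkeeping is needed here.
-/

set_option linter.dupNamespace false -- mandated namespace of this single-conjunct summit

noncomputable section

open CategoryTheory AlgebraicGeometry TopologicalSpace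
open Literature.AlgebraicGeometry.Resolution Literature.RingTheory.HilbertSamuel

namespace Summit.ResolutionOfSingularities.ResolutionOfSingularities.Theorems.SigmaMaxModifications.Sketch

/-! ## The measure: the total `δ`-invariant of a quasi-excellent integral curve is finite -/

/-- The total `δ`-invariant `Σ_y δ(𝒪_{X,y})` of an integral Noetherian quasi-excellent scheme of
dimension `≤ 1` is finite (finite support, finite values). [cite: Kollar2007, §1.4] -/
private theorem curveResolution_finsum_pointDelta_ne_top {X : Scheme.{0}} [IsIntegral X]
    [IsNoetherian X] (hqe : Scheme.IsQuasiExcellent X) (hdim : topologicalKrullDim X ≤ 1) :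
    ∑ᶠ y, pointDelta X y ≠ ⊤ := by
  rw [finsum_eq_sum _
    (_root_.Literature.AlgebraicGeometry.Resolution.finite_support_pointDelta hqe hdim)]
  exact ENat.sum_ne_top.mpr fun y _ => pointDelta_ne_top hqe hdim y

/-! ## The integral case: induction on the total `δ`-invariant -/

/-- **Blowing up the singular points of an integral quasi-excellent curve terminates**, by strong
induction on the total `δ`-invariant `n = Σ_y δ(𝒪_{X,y})`: for `X` integral, Noetherian,
quasi-excellent of dimension `≤ 1` there is a finite sequence of blow-ups (in closed singular
points) with centres over `X ∖ Reg X` whose last scheme is regular — a singular point `x` is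
closed with `dim 𝒪_{X,x} = 1`, the blow-up of the reduced point is again an integral Noetherian
quasi-excellent curve, and `δ` drops (Kollár 2007, §1.4). [cite: Kollar2007, §1.4] -/
private theorem centreSeq_of_integral_curve_aux (n : ℕ) :
    ∀ (X : Scheme.{0}) [IsIntegral X] [IsNoetherian X], Scheme.IsQuasiExcellent X →
      topologicalKrullDim X ≤ 1 → (∑ᶠ y, pointDelta X y).toNat = n →
        ∃ s : CentreSeq X, s.CentresOver (Scheme.regularLocus X)ᶜ ∧ Scheme.IsRegular s.top := by
  induction n using Nat.strong_induction_on with | _ n ih =>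
  intro X hint hnoeth hqe hdim hδ
  by_cases hXreg : Scheme.IsRegular X
  · -- (1) regular: the empty sequence
    exact ⟨CentreSeq.nil X, CentreSeq.centresOver_nil _ _, hXreg⟩
  -- (2) a singular point `x`: closed, `dim 𝒪_{X,x} = 1`, not a DVR
  obtain ⟨x, hxreg⟩ : ∃ x : X, x ∉ Scheme.regularLocus X := not_forall.mp hXreg
  have h1 : ringKrullDim (X.presheaf.stalk x) = 1 :=
    (isField_or_ringKrullDim_eq_one hdim x).resolve_left fun hF =>
      hxreg (by
        show IsRegularLocalRing (X.presheaf.stalk x)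
        letI := hF.toField
        infer_instance)
  have hsing : ¬ IsDiscreteValuationRing (X.presheaf.stalk x) := fun hdvr =>
    hxreg (show IsRegularLocalRing (X.presheaf.stalk x) from inferInstance)
  have hxcl : IsClosed ({x} : Set X) := by
    have hcl : IsClosed (Scheme.regularLocus X)ᶜ :=
      (Scheme.isOpen_regularLocus_of_isQuasiExcellent hqe).isClosed_compl
    have hne : (Scheme.regularLocus X)ᶜ ≠ Set.univ := fun h =>
      (h.symm ▸ Set.mem_univ (genericPoint X) : genericPoint X ∈ (Scheme.regularLocus X)ᶜ)
        (genericPoint_mem_regularLocus X)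
    exact (Set.finite_and_isClosed_singleton_of_dim_le_one hdim hcl hne).2 x hxreg
  -- (3) blow up the reduced closed point `x`
  obtain ⟨C, hC⟩ : ∃ C : X.IdealSheafData,
      C = Scheme.IdealSheafData.vanishingIdeal ⟨{x}, hxcl⟩ := ⟨_, rfl⟩
  have hρ : IsBlowup (blowup.π C) (Scheme.IdealSheafData.vanishingIdeal ⟨{x}, hxcl⟩) := by
    rw [← hC]; exact blowup.isBlowup C
  have hCsupp : (C.support : Set X) = {x} := by
    rw [hC]; exact Scheme.IdealSheafData.coe_support_vanishingIdeal _
  have hCsing : (C.support : Set X) ⊆ (Scheme.regularLocus X)ᶜ := by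
    rw [hCsupp]; exact Set.singleton_subset_iff.mpr hxreg
  have hC0 : C ≠ ⊥ := by
    rw [hC]
    exact vanishingIdeal_ne_bot_of_subset_compl_regularLocus (Set.singleton_subset_iff.mpr hxreg)
  haveI : IsIntegral (blowup C) := (blowup.isBlowup C).isIntegral hC0
  haveI : IsProper (blowup.π C) := (blowup.isBlowup C).isProper
  haveI : IsLocallyNoetherian (blowup C) := LocallyOfFiniteType.isLocallyNoetherian (blowup.π C)
  haveI : CompactSpace (blowup C) := QuasiCompact.compactSpace_of_compactSpace (blowup.π C)
  haveI : IsNoetherian (blowup C) := {}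
  have hqe₁ : Scheme.IsQuasiExcellent (blowup C) := (blowup.isBlowup C).isQuasiExcellent hqe
  have hdim₁ : topologicalKrullDim (blowup C) ≤ 1 := by
    have := (blowup.isBlowup C).topologicalKrullDim_le (n := 1) (by exact_mod_cast hdim)
    exact_mod_cast this
  -- (4) the total `δ`-invariant drops
  haveI := module_finite_integralClosure_stalk hqe hdim x
  have hfin : ∀ x' : blowup C, blowup.π C x' = x → Module.Finite ((blowup C).presheaf.stalk x')
      (integralClosure ((blowup C).presheaf.stalk x') (blowup C).functionField) :=
    fun x' _ => module_finite_integralClosure_stalk hqe₁ hdim₁ x'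
  obtain ⟨-, hlt⟩ := IsBlowup.finsum_pointDelta_lt_of_vanishingIdeal hxcl hρ h1 hfin
    (_root_.Literature.AlgebraicGeometry.Resolution.finite_support_pointDelta hqe hdim)
    (pointDelta_ne_top hqe hdim) hsing
  have htop : ∑ᶠ y, pointDelta X y ≠ ⊤ := curveResolution_finsum_pointDelta_ne_top hqe hdim
  have hm : (∑ᶠ y', pointDelta (blowup C) y').toNat < n := by
    rw [← hδ]
    have key : ((∑ᶠ y', pointDelta (blowup C) y').toNat : ℕ∞) <
        ((∑ᶠ y, pointDelta X y).toNat : ℕ∞) := by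
      rwa [ENat.coe_toNat hlt.ne_top, ENat.coe_toNat htop]
    exact_mod_cast key
  -- (5) recurse and prepend the centre
  obtain ⟨s₁, hover₁, hreg₁⟩ := ih _ hm (blowup C) hqe₁ hdim₁ rfl
  exact ⟨CentreSeq.cons C s₁, CentreSeq.centresOver_compl_regularLocus_cons C s₁ hCsing hover₁,
    hreg₁⟩

/-- **Resolution of an integral quasi-excellent curve, isomorphic over the regular locus**: an
integral Noetherian quasi-excellent scheme of dimension `≤ 1` has a resolution of singularities
which is an isomorphism over an open whose points are exactly `Reg X` (the composite of the point
blow-ups of `centreSeq_of_integral_curve_aux`; `Reg X` is a dense open).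
[cite: Kollar2007, §1.4] -/
private theorem exists_isResolution_regularLocus_of_integral_curve (X : Scheme.{0}) [IsIntegral X]
    [IsNoetherian X] (hqe : Scheme.IsQuasiExcellent X) (hdim : topologicalKrullDim X ≤ 1) :
    ∃ (X' : Scheme.{0}) (π : X' ⟶ X), IsResolution π ∧
      ∃ U : X.Opens, (U : Set X) = Scheme.regularLocus X ∧ IsIso (π ∣_ U) := by
  obtain ⟨s, hs, hreg⟩ := centreSeq_of_integral_curve_aux _ X hqe hdim rfl
  exact ⟨s.top, s.comp, exists_isResolution_of_centreSeq hqe s hs hreg⟩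

/-! ## The stub -/

/-- **RESOLUTION OF REDUCED EXCELLENT CURVES, ISOMORPHIC OVER THE REGULAR LOCUS.** Every reduced
separated excellent Noetherian scheme `Y` of dimension `≤ 1` has a resolution of singularities
`ρ : Y' → Y` (proper, birational, `Y'` regular) which is an isomorphism over an open `V` whose
points are exactly `Reg Y`. Blow up singular points: the total `δ`-invariant of each integral
component drops (Kollár 2007, §1.4), and the component induction of Cossart–Piltant Thm. 1.1,
Step 1 glues (`exists_isResolution_regularLocus_of_irreducibleComponents`, with the property
"closed subscheme of `Y`": closed subschemes of `Y` are Noetherian, quasi-excellent, of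
dimension `≤ 1`). [cite: Kollar2007, §1.4] -/
theorem stub_curveResolution :
    ∀ (Y : Scheme.{0}) [Y.IsSeparated] [IsNoetherian Y] [IsReduced Y],
      Scheme.IsExcellent Y → topologicalKrullDim Y ≤ ((1 : ℕ) : WithBot ℕ∞) →
        ∃ (Y' : Scheme.{0}) (ρ : Y' ⟶ Y), IsResolution ρ ∧
          ∃ V : Y.Opens, (V : Set Y) = Scheme.regularLocus Y ∧ IsIso (ρ ∣_ V) := by
  intro Y _ _ _ hexc hdim
  refine exists_isResolution_regularLocus_of_irreducibleComponents
    (fun Z => ∃ i : Z ⟶ Y, IsClosedImmersion i) ?_ ?_ Y ⟨𝟙 Y, inferInstance⟩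
  · rintro X' Z i hi ⟨j, hj⟩
    exact ⟨i ≫ j, inferInstance⟩
  · rintro Z _ _ ⟨j, hj⟩
    have hqeZ : Scheme.IsQuasiExcellent Z :=
      Scheme.IsQuasiExcellent.of_isClosedImmersion j hexc.isQuasiExcellent
    have hdimZ : topologicalKrullDim Z ≤ 1 := by
      have h := j.isClosedEmbedding.isInducing.topologicalKrullDim_le
      exact_mod_cast h.trans hdim
    exact exists_isResolution_regularLocus_of_integral_curve Z hqeZ hdimZ

end Summit.ResolutionOfSingularities.ResolutionOfSingularities.Theorems.SigmaMaxModifications.Sketch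

end
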